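import Mathlib
import Literature.NumberTheory.Automorphic.HilbertModularFormQExpansion
import Summits.Langlands.Langlands.Theorems.CapacityClassicalityHilbertIntegralOverconvergentIsCongruenceKoecherGlue
import Summits.Langlands.Langlands.Theorems.CapacityClassicalityHilbertIntegralOverconvergentIsCongruenceStubSlashMul
import Summits.Langlands.Langlands.Theorems.CapacityClassicalityHilbertIntegralOverconvergentIsCongruenceStubDualLatticeEquiv
import Summits.Langlands.Langlands.Theorems.CapacityClassicalityHilbertIntegralOverconvergentIsCongruenceStubPairingCubePoint
import Summits.Langlands.Langlands.Theorems.CapacityClassicalityHilbertIntegralOverconvergentIsCongruenceStubFourierCoeffAtOfHasSum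

/-!
# The unit Hilbert modular form `1_ℍ` and its `q`-expansion (stub P4)

Stub P4 `stub_indicator_modularForm` of line Sketch-ideate-r1-k1 (section P, the `q`-expansion
principle over `ℂ`) for the crux `HilbertIntegralOverconvergentIsCongruence` (stmt-Langlands-8485).
The vocabulary's space `modularForms Γ k` consists of functions on the ambient space `ℂ^{Hom(F,ℝ)}`
normalised to `0` off the tube domain `ℍ`, so the unit of the graded algebra of Hilbert modular forms
is the indicator function `1_ℍ` of `ℍ`.  We prove that `1_ℍ` is a Hilbert modular form of weight `0`
for every level `Γ ≤ SL₂(𝓞 F)` (it is the constant `1` on the open set `ℍ`, the Möbius action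
preserves `ℍ` — landed `slm_moeb_mem_halfSpace` — and `J_0 = 1`), and that its Fourier coefficients
on the dual lattice `𝔡⁻¹` are `a_0 = 1`, `a_μ = 0` for `μ ≠ 0`: in cube coordinates the phase is
`S(μ(x + i)) = n·x + i ∑_σ σ(μ)` with `n = (Tr(μ b_i))_i ∈ ℤ^ι` (landed `stub_pairing_cubePoint`,
`stub_dualLatticeEquiv`), and `∫_{[0,1]^ι} e^{-2πi n·x} dx = [n = 0]` (landed `qu_cube_orthogonality`).
-/

set_option linter.dupNamespace false

noncomputable section

namespace Summit.Langlands.Langlands.Theorems.HilbertIntegralOverconvergentIsCongruence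

open MeasureTheory Complex NumberField
open Literature.NumberTheory.Automorphic Literature.NumberTheory.Automorphic.HilbertModular
open scoped MatrixGroups

/-- The automorphy factor of weight `0` is `1`. -/
theorem ind_autFactor_zero {F : Type} [Field F] [NumberField F] (g : SL(2, F)) (z : Point F) :
    autFactor (0 : (F →+* ℝ) → ℤ) g z = 1 := by
  simp [autFactor]

/-- `1_ℍ` equals `1` on `ℍ`. -/
theorem ind_indicator_of_mem {F : Type} [Field F] [NumberField F] {z : Point F}
    (hz : z ∈ halfSpace F) : (halfSpace F).indicator (fun _ ↦ (1 : ℂ)) z = 1 :=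
  Set.indicator_of_mem hz _

/-- **`1_ℍ` is a Hilbert modular form of weight `0`** for every level `Γ ≤ SL₂(𝓞 F)`. -/
theorem ind_indicator_mem_modularForms (F : Type) [Field F] [NumberField F]
    (Γ : Subgroup SL(2, 𝓞 F)) :
    (halfSpace F).indicator (fun _ ↦ (1 : ℂ)) ∈ modularForms Γ 0 := by
  refine ⟨?_, ?_, ?_, ?_⟩
  · -- holomorphic: agrees with the constant `1` on the open set `ℍ`
    exact (differentiableOn_const (1 : ℂ)).congr fun z hz ↦ ind_indicator_of_mem hz
  · -- weight-`0` law
    intro γ _ z hz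
    rw [ind_indicator_of_mem hz, ind_indicator_of_mem (slm_moeb_mem_halfSpace (toSL2F γ) hz),
      ind_autFactor_zero, mul_one]
  · -- bounded at every cusp: `1_ℍ |_0 g = 1` on `ℍ`
    intro g
    refine ⟨1, 0, fun z hz _ ↦ ?_⟩
    simp only [slash, ind_autFactor_zero, inv_one, one_mul,
      ind_indicator_of_mem (slm_moeb_mem_halfSpace g hz), norm_one, le_refl]
  · -- vanishes off `ℍ`
    exact fun z hz ↦ Set.indicator_of_notMem hz _

/-- The Fourier coefficient of `1_ℍ` at `μ`, unfolded: the integrand is the bare character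
`e^{-2πi S(μ(x + i))}` (the cube points at height `1` lie in `ℍ`). -/
theorem ind_fourierCoeff_eq (F : Type) [Field F] [NumberField F] (μ : F) :
    fourierCoeff ((halfSpace F).indicator (fun _ ↦ (1 : ℂ))) μ =
      ∫ x in Set.Icc (0 : Coord F) 1,
        cexp (-(2 * Real.pi * I * pairing μ (cubePoint x fun _ ↦ (1 : ℝ)))) := by
  rw [fourierCoeff_eq, fourierCoeffAt]
  refine setIntegral_congr_fun measurableSet_Icc fun x _ ↦ ?_
  rw [ind_indicator_of_mem (koe_cubePoint_mem_halfSpace x fun _ ↦ one_pos), one_mul]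

/-- The unit cube of the coordinate space has volume `1`. -/
theorem ind_volume_real_cube (F : Type) [Field F] [NumberField F] :
    (volume : Measure (Coord F)).real (Set.Icc 0 1) = 1 := by
  rw [measureReal_def, Real.volume_Icc_pi_toReal zero_le_one]
  simp

/-- **`a_0(1_ℍ) = 1`.** -/
theorem ind_fourierCoeff_zero (F : Type) [Field F] [NumberField F] :
    fourierCoeff ((halfSpace F).indicator (fun _ ↦ (1 : ℂ))) 0 = 1 := by
  rw [ind_fourierCoeff_eq]
  have h : ∀ x : Coord F, cexp (-(2 * Real.pi * I * pairing (0 : F) (cubePoint x fun _ ↦ (1 : ℝ)))) = 1 :=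
    fun x ↦ by simp [pairing]
  simp_rw [h]
  rw [setIntegral_const, ind_volume_real_cube, one_smul]

/-- **`a_μ(1_ℍ) = 0` for `0 ≠ μ ∈ 𝔡⁻¹`** (phase bookkeeping in cube coordinates and orthogonality of
the characters on the unit cube). -/
theorem ind_fourierCoeff_of_ne_zero (F : Type) [Field F] [NumberField F] [NumberField.IsTotallyReal F]
    (μ : F) (hμ : ∀ a : 𝓞 F, ∃ n : ℤ, Algebra.trace ℚ F (μ * a) = n) (hμ0 : μ ≠ 0) :
    fourierCoeff ((halfSpace F).indicator (fun _ ↦ (1 : ℂ))) μ = 0 := by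
  classical
  obtain ⟨e, he⟩ := stub_dualLatticeEquiv F
  set n : Module.Free.ChooseBasisIndex ℤ (𝓞 F) → ℤ := e ⟨μ, hμ⟩
  -- `n ≠ 0` since `e` is injective and `e 0 = 0`
  have hn0 : n ≠ 0 := by
    intro h
    have h0 : e ⟨0, fun _ ↦ ⟨0, by simp⟩⟩ = 0 := by
      funext i
      apply Int.cast_injective (α := ℚ)
      rw [he]
      simp
    have := e.injective (h.trans h0.symm)
    exact hμ0 (congrArg Subtype.val this)
  -- the phase in cube coordinates
  set B : ℝ := ∑ σ : F →+* ℝ, σ μ * (1 : ℝ) with hBdef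
  have hphase : ∀ x : Coord F, cexp (-(2 * Real.pi * I * pairing μ (cubePoint x fun _ ↦ (1 : ℝ)))) =
      (Real.exp (2 * Real.pi * B) : ℂ) * cexp (2 * Real.pi * I * (∑ i, ((-n) i : ℝ) * x i : ℝ)) := by
    intro x
    rw [stub_pairing_cubePoint F μ n (he ⟨μ, hμ⟩) x fun _ ↦ (1 : ℝ), Complex.ofReal_exp,
      ← Complex.exp_add]
    congr 1
    simp only [hBdef, Pi.neg_apply, Int.cast_neg, neg_mul, Finset.sum_neg_distrib]
    push_cast
    ring_nf
    rw [Complex.I_sq]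
    ring
  rw [ind_fourierCoeff_eq]
  simp_rw [hphase]
  rw [integral_const_mul, qu_cube_orthogonality, if_neg (neg_ne_zero.2 hn0), mul_zero]

/-- **stub P4 — `stub_indicator_modularForm`.** The indicator function of `ℍ` (the constant `1`,
normalised to `0` off `ℍ`) is a Hilbert modular form of weight `0` for every level, and its Fourier
coefficients on the dual lattice are `[μ = 0]` (cube orthogonality, landed `qu_cube_orthogonality`).
[folklore] -/
theorem stub_indicator_modularForm (F : Type) [Field F] [NumberField F] [NumberField.IsTotallyReal F]
    (Γ : Subgroup SL(2, 𝓞 F)) :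
    (halfSpace F).indicator (fun _ ↦ (1 : ℂ)) ∈ modularForms Γ 0 ∧
      fourierCoeff ((halfSpace F).indicator (fun _ ↦ (1 : ℂ))) 0 = 1 ∧
      ∀ μ : F, (∀ a : 𝓞 F, ∃ n : ℤ, Algebra.trace ℚ F (μ * a) = n) → μ ≠ 0 →
        fourierCoeff ((halfSpace F).indicator (fun _ ↦ (1 : ℂ))) μ = 0 :=
  ⟨ind_indicator_mem_modularForms F Γ, ind_fourierCoeff_zero F,
    fun μ hμ hμ0 ↦ ind_fourierCoeff_of_ne_zero F μ hμ hμ0⟩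

end Summit.Langlands.Langlands.Theorems.HilbertIntegralOverconvergentIsCongruence

end
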